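import Literature.AlgebraicGeometry.Morphisms.CechModuleFiniteLocallyFreePullback
import Literature.AlgebraicGeometry.Morphisms.CechModuleCoverIndependence
import Literature.AlgebraicGeometry.Motives.AbelianVarietyDegreeCubeProofs
import Literature.AlgebraicGeometry.Motives.AbelianVarietyKerRankProofs
import Literature.AlgebraicGeometry.Motives.AbelianVarietyLie
import Literature.AlgebraicGeometry.Motives.CartierDivisorPullbackLineBundleIso
import Literature.AlgebraicGeometry.Motives.CartierDivisorLinEquivIso
import Literature.AlgebraicGeometry.Modules.LineBundleOfCocycleClass
import Literature.AlgebraicGeometry.Modules.VanishingLocusFiniteLocallyFree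
import HarnessLib

/-!
# `H¹(A, 𝒪(Θ)) = 0` for a SYMMETRIC divisor `Θ` on an abelian variety whose large multiples have `Ȟ¹ = 0`
# (Mumford's `[n]`-trick; Mumford, *Abelian Varieties*, §16 «the vanishing theorem», degree-one / symmetric case)

Layer `Literature/AlgebraicGeometry/AbelianVarieties`, namespace `Literature.AlgebraicGeometry.Motives.AbelianVariety` (as the ★
`AbelianVarietyDegree*` files) with one generic lemma in `Literature.AlgebraicGeometry.Morphisms`.  THEOREMS ONLY (no definition, no named
fact, no instance, no `sorry`).

[MumfordAV1970] §16 proves `H^i(A, L) = 0` for `i > 0` and `L` ample on an abelian variety over an algebraically closed field (the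
«vanishing theorem», via the index).  This file proves the DEGREE-ONE case for SYMMETRIC `L = 𝒪_A(Θ)` over ANY field `k`, by the
`[n]`-trick, from the vanishing of `Ȟ¹` of the large multiples `𝒪(m • Θ)` (Serre's vanishing theorem for `Θ` ample — the sibling file
`Modules/SerreVanishingAmpleMultiples`, cell hodgecm-mathlib V2; here an explicit hypothesis `hvan`, so that this file is Serre-free):

  pick `n₀ ∈ {2, 3}` prime to `char k` and `n := n₀ ^ N`; `[n]_A` is an isogeny (★ `isIsogeny_zsmul_id_of_cast_ne_zero`), finite
  flat of constant rank `n^{2g}` (★ `IsIsogeny.finrank_eq_kerRank`, ★ `kerRank_zsmul_id_holds` — [GortzWedhorn2023] Prop. 27.186),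
  INVERTIBLE in `k`; so `Ȟ¹(𝒰, 𝒪(Θ)) = 0` follows from `Ȟ¹([n]⁻¹𝒰, [n]^*𝒪(Θ)) = 0` (★ trace retraction,
  `Morphisms/CechModuleFiniteLocallyFreePullback`, [StacksProject] Tag 0BVH), and `[n]^*𝒪(Θ) ≅ 𝒪([n]^*Θ) ≅ 𝒪(n² • Θ)`
  (★ `CartierDivisor.pullbackLineBundleIso`, ★ `AbelianVariety.pullback_zsmul_id_linEquiv_holds` — [GortzWedhorn2023] Prop. 27.184 (1) /
  Rem. 27.185 for SYMMETRIC `Θ` — and ★ `LinEquiv.nonempty_lineBundle_iso`), whose `Ȟ¹` vanishes on the affine cover `[n]⁻¹𝒰` as soon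
  as it vanishes on `𝒰` (★ cover independence `subsingleton_cechMH1_iff_of_isAffineOpen`, [Hartshorne1977] III Thm. 4.5), since
  `n² ≥ 2^N > N`.

* `Morphisms.subsingleton_cechMH1_iff_of_hom` — the vanishing of `Ȟ¹(𝒰, M)` does not depend on the structure morphism `Y → Spec A`
  through which the cochain groups are regarded as `A`-modules (bookkeeping; nor on the isomorphism class of `M` — the retract lemma of
  ★ `Morphisms/CechModuleFiniteLocallyFreePullback` with `n = 1`);
* **`AbelianVariety.subsingleton_cechMH1_lineBundle_of_symmetric_of_forall_nsmul`** — THE HEAD: `Ȟ¹(𝒰, 𝒪_A(Θ)) = 0` on every finite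
  affine open cover `𝒰` of `A`, for `Θ` symmetric with `Ȟ¹(𝒰, 𝒪_A(m • Θ)) = 0` for all `m ≥ N`.

Ampleness is NOT a hypothesis here (it only serves, through Serre, to produce `hvan`); no algebraic closure, any characteristic.  Cell
`hodgecm-mathlib` (D-0151), F-DAG leaf F-2 (b) FIELD CASE, road of record «`[n]`-trick» (B-plan1 (g16) 2026-08-30T07:21:48Z), file V3 of
`B-provers/B-p05/g17/CENSUS-F2b-FieldVanishing.B-p05g17.md`; consumers: V4 `AbelianSchemes/AbelianSchemeLDeltaFibreH1Vanishing` (the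
`Ext¹` socket of the (hbc)/F-6 (VI) embedding package at `L^Δ(λ)^{⊗3}`).  Count-neutral; HC_CM is proved only modulo the 7 printed
citations until rung 0 closes — nothing here refers to it.

## References
* [MumfordAV1970] D. Mumford, *Abelian Varieties*, TIFR Studies in Mathematics 5 (1970), §16 (the vanishing theorem), §6 Cor. 3 (`[n]^*L`).
* [GortzWedhorn2023] U. Görtz, T. Wedhorn, *Algebraic Geometry II: Cohomology of Schemes* (2023), Prop. 27.184 (1), Rem. 27.185, Prop. 27.186,
  Prop. 27.187.
* [StacksProject] The Stacks Project, Tag 0BVH (trace of a finite locally free morphism).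
* [Hartshorne1977] R. Hartshorne, *Algebraic Geometry*, GTM 52 (1977), III Thm. 4.5 (Čech cohomology on affine covers), III Ex. 4.1.
-/

noncomputable section

universe u v w

open CategoryTheory AlgebraicGeometry TopologicalSpace Opposite
open AlgebraicGeometry.Scheme.Modules

/-! ## §1 Bookkeeping: the structure morphism is irrelevant to `Ȟ¹ = 0` -/

namespace Literature.AlgebraicGeometry.Morphisms

variable {A : Type u} [CommRing A] {Y : Scheme.{u}} (g g' : Y ⟶ Spec (.of A)) (M : Y.Modules) {ι : Type v} (U : ι → Y.Opens)

/-- The `1`-cocycles and `1`-coboundaries of `M` on `𝒰` do not depend on the structure morphism `Y → Spec A` (only the `A`-module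
structure of the cochain groups does): `Ž¹ ⊆ B̌¹` for `g` iff for `g'`. [cite: StacksProject, Tag 01ED] -/
theorem cechMZ1_le_cechMB1_iff_of_hom :
    cechMZ1 g M U ≤ cechMB1 g M U ↔ cechMZ1 g' M U ≤ cechMB1 g' M U := by
  constructor
  · intro h c hc
    rw [mem_cechMZ1_iff] at hc
    let c' : CechMC1 g M U := fun i j => c i j
    have hc' : c' ∈ cechMZ1 g M U := by rw [mem_cechMZ1_iff]; exact hc
    obtain ⟨b, hb⟩ := (mem_cechMB1_iff g M U c').1 (h hc')
    rw [mem_cechMB1_iff]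
    exact ⟨fun i => b i, hb⟩
  · intro h c hc
    rw [mem_cechMZ1_iff] at hc
    let c' : CechMC1 g' M U := fun i j => c i j
    have hc' : c' ∈ cechMZ1 g' M U := by rw [mem_cechMZ1_iff]; exact hc
    obtain ⟨b, hb⟩ := (mem_cechMB1_iff g' M U c').1 (h hc')
    rw [mem_cechMB1_iff]
    exact ⟨fun i => b i, hb⟩

/-- **`Ȟ¹(𝒰, M) = 0` does not depend on the structure morphism `Y → Spec A`.** [cite: StacksProject, Tag 01ED] -/
theorem subsingleton_cechMH1_iff_of_hom : Subsingleton (CechMH1 g M U) ↔ Subsingleton (CechMH1 g' M U) := by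
  rw [subsingleton_cechMH1_iff_cechMZ1_le_cechMB1 g U, subsingleton_cechMH1_iff_cechMZ1_le_cechMB1 g' U]
  exact cechMZ1_le_cechMB1_iff_of_hom g g' M U

end Literature.AlgebraicGeometry.Morphisms

/-! ## §2 The `[n]`-trick -/

namespace Literature.AlgebraicGeometry.Motives

namespace AbelianVariety

open Literature.AlgebraicGeometry.Morphisms Literature.AlgebraicGeometry.Modules

variable {k : Type u} [Field k] (A : AbelianVariety k)

/-- An integer `n₀ ∈ {2, 3}` invertible in the field `k` (`3` in characteristic `2`, else `2`). [folklore] -/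
private theorem exists_two_le_cast_ne_zero : ∃ n₀ : ℕ, 2 ≤ n₀ ∧ (n₀ : k) ≠ 0 := by
  by_cases h2 : (2 : k) = 0
  · refine ⟨3, by norm_num, fun h3 => ?_⟩
    have h1 : (1 : k) = 0 := by
      have : (3 : k) - 2 = 0 := by rw [h2, sub_zero]; exact_mod_cast h3
      norm_num at this
    exact one_ne_zero h1
  · exact ⟨2, le_rfl, by exact_mod_cast h2⟩

/-- **`Ȟ¹(𝒰, 𝒪_A(Θ)) = 0` for `Θ` SYMMETRIC whose multiples `m • Θ`, `m ≥ N`, have `Ȟ¹(𝒰, 𝒪_A(m • Θ)) = 0`** (Mumford's `[n]`-trick,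
degree one), on every finite affine open cover `𝒰` of an abelian variety `A` over any field `k`: with `n = n₀^N` prime to `char k`,
`Ȟ¹(𝒰, 𝒪(Θ))` embeds (trace retraction for the finite flat `[n]_A` of invertible degree `n^{2g}`) into
`Ȟ¹([n]⁻¹𝒰, [n]^*𝒪(Θ)) = Ȟ¹([n]⁻¹𝒰, 𝒪(n² • Θ)) = 0` (`n² ≥ N`; cover independence on affine covers).
[cite: MumfordAV1970, §16 (the vanishing theorem) and §6 Cor. 3] [cite: GortzWedhorn2023, Prop. 27.184 (1), Rem. 27.185 and Prop. 27.186]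
[cite: StacksProject, Tag 0BVH] [cite: Hartshorne1977, III Thm. 4.5] -/
theorem subsingleton_cechMH1_lineBundle_of_symmetric_of_forall_nsmul (Θ : CartierDivisor A.X.left)
    (hsym : (Θ.pullback (Hom.toSchemeHom (-𝟙 A))).LinEquiv Θ)
    {ι : Type v} [Finite ι] (U : ι → A.X.left.Opens) (hU : ∀ i, IsAffineOpen (U i)) (hcov : ⨆ i, U i = ⊤)
    (N : ℕ) (hvan : ∀ m : ℕ, N ≤ m → Subsingleton (CechMH1 A.X.hom (Modules.lineBundle (m • Θ).toUnitCocycle) U)) :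
    Subsingleton (CechMH1 A.X.hom (Modules.lineBundle Θ.toUnitCocycle) U) := by
  classical
  -- (1) the integer `n = n₀ ^ N`, prime to the characteristic, with `N ≤ n²`
  obtain ⟨n₀, hn₀, hn₀k⟩ := exists_two_le_cast_ne_zero (k := k)
  set n : ℕ := n₀ ^ N with hn
  have hnk : (n : k) ≠ 0 := by rw [hn, Nat.cast_pow]; exact pow_ne_zero _ hn₀k
  have hNn : N ≤ n ^ 2 := by
    calc N ≤ 2 ^ N := Nat.lt_two_pow_self.le
      _ ≤ n₀ ^ N := Nat.pow_le_pow_left hn₀ N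
      _ = n := hn.symm
      _ ≤ n ^ 2 := Nat.le_self_pow two_ne_zero n
  -- (2) `f = [n]_A`: an isogeny, finite, flat, dominant, of constant rank `n ^ (2 dim A)` invertible in `k`
  set nZ : ℤ := (n : ℤ) with hnZ
  have hnZk : (nZ : k) ≠ 0 := by rw [hnZ, Int.cast_natCast]; exact hnk
  have hnZ0 : nZ ≠ 0 := fun h => hnZk (by rw [h, Int.cast_zero])
  have hiso : IsIsogeny (nZ • 𝟙 A) := A.isIsogeny_zsmul_id_of_cast_ne_zero nZ hnZk
  set f : A.X.left ⟶ A.X.left := Hom.toSchemeHom (nZ • 𝟙 A) with hf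
  haveI : IsFinite f := hiso.2
  haveI : Flat f := IsIsogeny.flat_toSchemeHom_holds hiso
  haveI : IsDominant f := ⟨hiso.1.1.denseRange⟩
  haveI : IsLocallyNoetherian A.X.left := LocallyOfFiniteType.isLocallyNoetherian A.X.hom
  have hrk : ∀ y : A.X.left, f.finrank y = nZ.natAbs ^ (2 * A.dim) := fun y =>
    (IsIsogeny.finrank_eq_kerRank hiso y).trans (A.kerRank_zsmul_id_holds nZ hnZ0)
  have habs : nZ.natAbs = n := by rw [hnZ, Int.natAbs_natCast]
  have hunit : IsUnit ((nZ.natAbs ^ (2 * A.dim) : ℕ) : k) := by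
    rw [isUnit_iff_ne_zero, Nat.cast_pow, habs]
    exact pow_ne_zero _ hnk
  -- (3) the line bundle `𝒪(Θ)` is affine-localizing
  set L : A.X.left.Modules := Modules.lineBundle Θ.toUnitCocycle with hL
  have hLaff : IsAffineLocalizing L := isAffineLocalizing_of_isFiniteLocallyFree (UnitCocycle.isFiniteLocallyFree_lineBundle _)
  -- (4) upstairs: `[n]^*𝒪(Θ) ≅ 𝒪(n² • Θ)` has `Ȟ¹ = 0` on `[n]⁻¹𝒰`
  set m : ℕ := nZ.natAbs ^ 2 with hm
  have hNm : N ≤ m := by rw [hm, habs]; exact hNn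
  have e₁ : (pullback f).obj L ≅ Modules.lineBundle (Θ.pullback f).toUnitCocycle := Θ.pullbackLineBundleIso f
  have e₂ : Modules.lineBundle (Θ.pullback f).toUnitCocycle ≅ Modules.lineBundle (m • Θ).toUnitCocycle :=
    (CartierDivisor.LinEquiv.nonempty_lineBundle_iso (A.pullback_zsmul_id_linEquiv_holds Θ hsym nZ)).some
  have hUf : ∀ i, IsAffineOpen (f ⁻¹ᵁ U i) := fun i => (hU i).preimage f
  have hcovf : ⨆ i, f ⁻¹ᵁ U i = ⊤ := by
    rw [← Scheme.Hom.preimage_iSup, hcov]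
    rfl
  have hmaff : IsAffineLocalizing (Modules.lineBundle (m • Θ).toUnitCocycle) :=
    isAffineLocalizing_of_isFiniteLocallyFree (UnitCocycle.isFiniteLocallyFree_lineBundle _)
  -- on `𝒰`, then on `[n]⁻¹𝒰` (cover independence), then for the structure morphism `f ≫ π`, then along `e₁ ≪≫ e₂`
  haveI h₁ : Subsingleton (CechMH1 A.X.hom (Modules.lineBundle (m • Θ).toUnitCocycle) (fun i => f ⁻¹ᵁ U i)) :=
    (subsingleton_cechMH1_iff_of_isAffineOpen A.X.hom hmaff U (fun i => f ⁻¹ᵁ U i) hU hUf hcov hcovf).1 (hvan m hNm)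
  haveI h₂ : Subsingleton (CechMH1 (f ≫ A.X.hom) (Modules.lineBundle (m • Θ).toUnitCocycle) (fun i => f ⁻¹ᵁ U i)) :=
    (subsingleton_cechMH1_iff_of_hom A.X.hom (f ≫ A.X.hom) _ _).1 h₁
  haveI h₃ : Subsingleton (CechMH1 (f ≫ A.X.hom) ((pullback f).obj L) (fun i => f ⁻¹ᵁ U i)) :=
    subsingleton_cechMH1_of_retract_nsmul (f ≫ A.X.hom) (fun i => f ⁻¹ᵁ U i) (e₁ ≪≫ e₂).hom (e₁ ≪≫ e₂).inv 1
      (by rw [Iso.hom_inv_id, one_nsmul]) (by simp)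
  -- (5) descend along `[n]_A` (degree `n^{2g}` invertible)
  exact subsingleton_cechMH1_of_subsingleton_cechMH1_pullback_of_finrank_eq A.X.hom f U (nZ.natAbs ^ (2 * A.dim)) hrk hunit L hLaff

end AbelianVariety

end Literature.AlgebraicGeometry.Motives

end
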